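import Literature.AlgebraicGeometry.Hyperkaehler.TranscendentalHodgeSimilitudesKugaSatake
import Summits.HodgeConjecture.HodgeConjecture.Theorems.MarkmanPartnerTransportIsometrySpannedThirdTopDegree
import Summits.HodgeConjecture.HodgeConjecture.Theorems.Ring2AbelianAllAndreCorrespondenceCategory
import HarnessLib

/-!
# Orphan levers, T1 «ORPH-KS» core: a quadratic transcendental endomorphism is cycle-induced on `T(X)`, modulo Kuga–Satake

Sub-problem `HodgeConjecture`, route MarkmanPartnerTransport, rung «ORPHAN-RM, real quadratic» (memo ROUTE-P1AJ,
target T1 of `Sketch_P1AJ_OrphanLevers_g37`). For a marked smooth projective `K3^{[2]}`-type fourfold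
`(X, φ, P, z)` (clauses (m1)–(m6) of the route) and an endomorphism `θ` of `H²(X(ℂ); ℂ)` that is rational,
type-preserving, `q`-self-adjoint, has `q`-transcendental image and satisfies `θ² = d ≠ 0` on the
`q`-transcendental space `T(X) = N¹(X)^{⊥_q}`, the map `θ|_{T(X)}` is a rational Hodge SELF-SIMILITUDE of
`T(X)` of multiplier `d` (for the Fujiki forms `d • b` and `b`, `b = q ∘ (φ × φ)`), hence — GRANTED the
Kuga–Satake Hodge conjecture for `X` (`IsKSCorrespondenceAlgebraicHK 2 _`, AV-sector input) and modulo the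
named facts {Varesco 2023 Cor. 4.6, Charles–Markman 2013} — induced on `T(X)` by an algebraic self-correspondence
of `X`, which we normalise to the complex orientations: `θ y = [Z]_* y` for all `y ∈ T(X)` with
`Z ∈ A⁴(X × X)`.

* §1 `isFujikiForm_markingForm` / `exists_isFujikiForm_marking` — `b(x, y) = q(φ x, φ y)` is a Fujiki form
  (`c = 3`, `P` the marked generator, `P ≠ 0` by `generator_ne_zero_of_markedSq`);
* §2 `mem_transcendentalPart_iff_bbfTransc` — Floccari–Varesco's `transcendentalPart X b` (`b`-orthogonal to the
  integral algebraic classes) is the route's `q`-transcendental space (`N¹(X)` is spanned by rational classes);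
  `transcendentalPart_smul`;
* §3 `exists_algebraicCorrespondence_eq_on_bbfTransc_of_kugaSatake` (Varesco's `T_alg` with `T_alg = θ` on
  `T(X)`) and `exists_corrAction_eq_on_bbfTransc_of_kugaSatake` (`T_alg = [Z]_*` for the complex orientations,
  `IsAlgebraicCorrespondence.exists_eq_corrAction`).

CONDITIONAL on `IsKSCorrespondenceAlgebraicHK 2 _` (hypothesis) and the two named facts; credits nothing to the
Hodge conjecture.

References: M. Varesco, Math. Z. 305 (2023), Thm. 4.5, Cor. 4.6, Rem. 5.5; F. Charles, E. Markman, Compos. Math.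
149 (2013) Thm. 1.1; D. Huybrechts, Invent. Math. 135 (1999) §1.9–1.11; A. Beauville, J. Differential Geom. 18
(1983) §8 Thm. 5, §9.
-/

noncomputable section

set_option linter.dupNamespace false

open Module CategoryTheory MonoidalCategory
open Literature.AlgebraicTopology.SingularHomology
open Literature.AlgebraicGeometry Literature.AlgebraicGeometry.Motives Literature.AlgebraicGeometry.HodgeTheory
open Literature.AlgebraicGeometry.Hyperkaehler Literature.AlgebraicGeometry.Surfaces
open Summit.HodgeConjecture.HodgeConjecture.Theorems.MarkmanPartnerTransport.PartnerLattice

namespace Summit.HodgeConjecture.HodgeConjecture.Theorems.MarkmanPartnerTransport.OrphanKS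

/-- `MarkedK3Sq[X, φ, P, z]`: VERBATIM the `let MarkedK3Sq := …` binder of the route declarations of
MarkmanPartnerTransport (clauses (m1)–(m6)). Local notation only. -/
local notation3 (prettyPrint := false) "MarkedK3Sq[" X ", " φ ", " P ", " z "]" =>
  (((IsIntegralClass P ∧ ∀ Q : complexBetti X (2 * 4), IsIntegralClass Q → ∃ n : ℤ, Q = n • P) ∧
    (∀ c : complexBetti X 2, IsIntegralClass c ↔ ∃ v : K3HilbertIndex → ℤ, φ c = fun i => (v i : ℂ)) ∧
    (∀ a : complexBetti X 2, cupPowTwo a 4 = ((3 : ℂ) * (k3HilbertForm 2 (φ a) (φ a)) ^ 2) • P) ∧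
    (IsOfHodgeType 4 X 2 2 0 (LinearEquiv.symm φ z) ∧
      ∀ τ : complexBetti X 2, IsOfHodgeType 4 X 2 2 0 τ → ∃ t : ℂ, τ = t • LinearEquiv.symm φ z) ∧
    (∀ c : complexBetti X 2, IsOfHodgeType 4 X 2 1 1 c ↔
      (k3HilbertForm 2 (φ c) z = 0 ∧ k3HilbertForm 2 (φ c) (star z) = 0)) ∧
    (k3HilbertForm 2 z z = 0 ∧ 0 < (k3HilbertForm 2 (star z) z).re)))

/-- `qC` = the complex Beauville–Bogomolov form of `K3^{[2]}`-type on `ℂ²³` as a Mathlib bilinear form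
(as in `…PartnerExistenceLattice`, `qC_apply`). -/
local notation3 (prettyPrint := false) "qC" => Matrix.toBilin' (Matrix.map (k3HilbertGram 2) (Int.cast : ℤ → ℂ))

variable {X : SchemeOver ℂ} {φ : complexBetti X 2 ≃ₗ[ℂ] (K3HilbertIndex → ℂ)} {P : complexBetti X (2 * 4)}
  {z : K3HilbertIndex → ℂ}

/-! ### §1 The Fujiki form of the marking -/

/-- The marking form `b = q ∘ (φ × φ)` evaluates as `b(x, y) = q(φ x, φ y)`. [cite: Beauville1983, §8 Thm. 5] -/
theorem markingForm_apply (x y : complexBetti X 2) :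
    ((qC).compl₁₂ (φ : complexBetti X 2 →ₗ[ℂ] (K3HilbertIndex → ℂ)) (φ : complexBetti X 2 →ₗ[ℂ] (K3HilbertIndex → ℂ)))
      x y = k3HilbertForm 2 (φ x) (φ y) := by
  rw [LinearMap.compl₁₂_apply, LinearEquiv.coe_coe, qC_apply]

/-- **The marking form `b(x, y) = q(φ x, φ y)` is a Fujiki form with `n = 2`**: symmetric, and Fujiki's relation
`a⁴ = 3 q(φ a)² · P` is clause (m3) of the marking, with `P ≠ 0` (`generator_ne_zero_of_markedSq`).
[cite: Beauville1983, §8 Thm. 5, §9] [cite: Huybrechts1999, §1.11] -/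
theorem isFujikiForm_markingForm (hX : IsSmoothProjective 4 X) (hM : MarkedK3Sq[X, φ, P, z]) :
    IsFujikiForm 2 X ((qC).compl₁₂ (φ : complexBetti X 2 →ₗ[ℂ] (K3HilbertIndex → ℂ))
      (φ : complexBetti X 2 →ₗ[ℂ] (K3HilbertIndex → ℂ))) := by
  obtain ⟨-, -, hcup, -⟩ := id hM
  refine ⟨fun x y => ?_, 3, P, three_ne_zero, generator_ne_zero_of_markedSq hX hM, fun a => ?_⟩
  · rw [markingForm_apply, markingForm_apply, k3HilbertForm_comm]
  · rw [markingForm_apply]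
    exact hcup a

/-- (T1 step (a)) **There is a Fujiki form `b` with `b(x, y) = q(φ x, φ y)`.** [cite: Beauville1983, §8 Thm. 5] -/
theorem exists_isFujikiForm_marking (hX : IsSmoothProjective 4 X) (hM : MarkedK3Sq[X, φ, P, z]) :
    ∃ b : complexBetti X 2 →ₗ[ℂ] complexBetti X 2 →ₗ[ℂ] ℂ,
      IsFujikiForm 2 X b ∧ ∀ x y, b x y = k3HilbertForm 2 (φ x) (φ y) :=
  ⟨_, isFujikiForm_markingForm hX hM, markingForm_apply⟩

/-! ### §2 The transcendental part of the marking form is the `q`-transcendental space -/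

/-- (T1 step (b)) **`transcendentalPart X b = T(X)` for `b = q ∘ (φ × φ)`**: a class is `b`-orthogonal to the
integral algebraic classes `NS(X)` iff it is `q`-orthogonal to all of `N¹(X) = NS(X) ⊗ ℂ` — `N¹(X)` is spanned by
rational classes (`supportedClasses_eq_span_isRationalClass`) and a rational class has an integral multiple
(`IsRationalClass.exists_nsmul_isIntegralClass`). The marking is not needed. [cite: Floccari2026, §1 and Rem. 3.4]
[cite: VoisinHodgeI2002, §7.1.1 and §11.3.1] -/
theorem mem_transcendentalPart_iff_bbfTransc (hX : IsSmoothProjective 4 X)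
    (b : complexBetti X 2 →ₗ[ℂ] complexBetti X 2 →ₗ[ℂ] ℂ)
    (hb : ∀ x y, b x y = k3HilbertForm 2 (φ x) (φ y)) (y : complexBetti X 2) :
    y ∈ transcendentalPart X b ↔
      ∀ e : complexBetti X 2, e ∈ algebraicClasses X 1 → k3HilbertForm 2 (φ y) (φ e) = 0 := by
  rw [mem_transcendentalPart_iff]
  constructor
  · intro h e he
    have hspan := supportedClasses_eq_span_isRationalClass hX 2 1
    change algebraicClasses X 1 =
      Submodule.span ℂ {c : complexBetti X 2 | IsRationalClass c ∧ c ∈ algebraicClasses X 1} at hspan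
    rw [hspan] at he
    refine Submodule.span_induction (p := fun e _ => k3HilbertForm 2 (φ y) (φ e) = 0) ?_ ?_ ?_ ?_ he
    · rintro c ⟨hcrat, hcN⟩
      obtain ⟨N, hN, hNc⟩ := hcrat.exists_nsmul_isIntegralClass hX
      have hmem : ((N : ℂ) • c) ∈ Surfaces.neronSeveriGroup X :=
        ⟨hNc, Submodule.smul_mem _ _ (hspan ▸ hcN)⟩
      have h0 := h _ hmem
      rw [hb, map_smul, ← qC_apply, map_smul, LinearMap.smul_apply, smul_eq_mul, mul_eq_zero] at h0
      rcases h0 with h0 | h0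
      · exact absurd h0 (Nat.cast_ne_zero.2 hN.ne')
      · rw [qC_apply] at h0
        rw [k3HilbertForm_comm]
        exact h0
    · rw [map_zero, ← qC_apply, map_zero]
    · intro u v _ _ hu hv
      rw [map_add, ← qC_apply, map_add, qC_apply, qC_apply, hu, hv, add_zero]
    · intro t u _ hu
      rw [map_smul, ← qC_apply, map_smul, qC_apply, hu, smul_zero]
  · intro h c hc
    rw [hb, k3HilbertForm_comm]
    exact h c hc.2

/-- `transcendentalPart` is unchanged by a non-zero rescaling of the form. [cite: Floccari2026, §1 and Rem. 3.4] -/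
theorem transcendentalPart_smul (b : complexBetti X 2 →ₗ[ℂ] complexBetti X 2 →ₗ[ℂ] ℂ) {t : ℂ} (ht : t ≠ 0) :
    transcendentalPart X (t • b) = transcendentalPart X b := by
  ext y
  simp only [mem_transcendentalPart_iff, LinearMap.smul_apply, smul_eq_mul, mul_eq_zero, ht, false_or]

/-! ### §3 T1 core: `θ` is cycle-induced on `T(X)`, modulo Kuga–Satake -/

/-- **T1 core (Varesco form).** For a marked smooth projective `K3^{[2]}`-type fourfold and `θ` rational,
type-preserving, `q`-self-adjoint, with `q`-transcendental image and `θ² = d ≠ 0` on `T(X)`: `θ|_{T(X)}` is a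
rational Hodge self-similitude of multiplier `d` (Fujiki forms `d • b`, `b`; bijective on `T(X)` since
`θ⁻¹ = d⁻¹ θ` there; `b(θ x, θ y) = b(x, θ² y) = d · b(x, y)`), so — GRANTED `IsKSCorrespondenceAlgebraicHK 2`
for `X` — Varesco's Cor. 4.6 with Charles–Markman's `B(X)` (`….of_k3HilbertType_target`) gives an algebraic
self-correspondence `T_alg` of `X` with `T_alg y = θ y` for every `q`-transcendental `y`. CONDITIONAL (Kuga–Satake
hypothesis; facts Varesco2023, CharlesMarkman2013). [cite: Varesco2023, Cor. 4.6 and Rem. 5.5]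
[cite: CharlesMarkman2013, Thm. 1.1 (§1)] -/
theorem exists_algebraicCorrespondence_eq_on_bbfTransc_of_kugaSatake
    (hB : CharlesMarkman2013_lefschetzStandard_K3HilbertType)
    (hVar : Varesco2023_transcendentalHodgeSimilitude_algebraic_of_lefschetzStandard)
    (hX : IsSmoothProjective 4 X) (hK : IsOfK3HilbertSquareType X) (hM : MarkedK3Sq[X, φ, P, z])
    (hIS : IsProjectiveIrreducibleSymplectic (2 * 2) X) (hKS : IsKSCorrespondenceAlgebraicHK 2 hIS.1)
    (θ : complexBetti X 2 →ₗ[ℂ] complexBetti X 2)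
    (h1 : ∀ y, IsRationalClass y → IsRationalClass (θ y))
    (h2 : ∀ (i j : ℕ) y, IsOfHodgeType 4 X 2 i j y → IsOfHodgeType 4 X 2 i j (θ y))
    (h4 : ∀ y : complexBetti X 2, ∀ d : complexBetti X 2, d ∈ algebraicClasses X 1 →
      k3HilbertForm 2 (φ (θ y)) (φ d) = 0)
    (h5 : ∀ y w : complexBetti X 2, k3HilbertForm 2 (φ (θ y)) (φ w) = k3HilbertForm 2 (φ y) (φ (θ w)))
    (d : ℚ) (hd : d ≠ 0)
    (hθθ : ∀ y : complexBetti X 2,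
      (∀ e : complexBetti X 2, e ∈ algebraicClasses X 1 → k3HilbertForm 2 (φ y) (φ e) = 0) →
      θ (θ y) = (d : ℂ) • y) :
    ∃ T : complexBetti X 2 →ₗ[ℂ] complexBetti X 2, IsAlgebraicCorrespondence 4 4 X X T ∧
      ∀ y : complexBetti X 2,
        (∀ e : complexBetti X 2, e ∈ algebraicClasses X 1 → k3HilbertForm 2 (φ y) (φ e) = 0) → T y = θ y := by
  classical
  obtain ⟨b, hb, hbq⟩ := exists_isFujikiForm_marking hX hM
  have hd' : (d : ℂ) ≠ 0 := by exact_mod_cast hd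
  have hb₁ : IsFujikiForm 2 X ((d : ℂ) • b) := hb.smul hd'
  have hT₁ : transcendentalPart X ((d : ℂ) • b) = transcendentalPart X b := transcendentalPart_smul b hd'
  have hmem : ∀ y, y ∈ transcendentalPart X b ↔
      ∀ e : complexBetti X 2, e ∈ algebraicClasses X 1 → k3HilbertForm 2 (φ y) (φ e) = 0 :=
    mem_transcendentalPart_iff_bbfTransc hX b hbq
  -- `θ` maps `T(X)` bijectively onto itself
  have hmaps : Set.MapsTo θ (transcendentalPart X ((d : ℂ) • b) : Set (complexBetti X 2))
      (transcendentalPart X b : Set (complexBetti X 2)) :=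
    fun y _ => (hmem _).2 (h4 y)
  have hinj : Set.InjOn θ (transcendentalPart X ((d : ℂ) • b) : Set (complexBetti X 2)) := by
    rw [hT₁]
    intro y hy y' hy' h
    have h' := congrArg θ h
    rw [hθθ y ((hmem y).1 hy), hθθ y' ((hmem y').1 hy')] at h'
    exact smul_right_injective _ hd' h'
  have hsurj : Set.SurjOn θ (transcendentalPart X ((d : ℂ) • b) : Set (complexBetti X 2))
      (transcendentalPart X b : Set (complexBetti X 2)) := by
    rw [hT₁]
    intro y hy
    refine ⟨(d : ℂ)⁻¹ • θ y, (transcendentalPart X b).smul_mem _ ((hmem _).2 (h4 y)), ?_⟩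
    show θ ((d : ℂ)⁻¹ • θ y) = y
    rw [map_smul, hθθ y ((hmem y).1 hy), smul_smul, inv_mul_cancel₀ hd', one_smul]
  have hbij : Set.BijOn θ (transcendentalPart X ((d : ℂ) • b) : Set (complexBetti X 2))
      (transcendentalPart X b : Set (complexBetti X 2)) := ⟨hmaps, hinj, hsurj⟩
  -- `θ` is a similitude of multiplier `d`: `b(θ x, θ y) = (d • b)(x, y)` on `T(X)`
  have hiso : ∀ x ∈ transcendentalPart X ((d : ℂ) • b), ∀ y ∈ transcendentalPart X ((d : ℂ) • b),
      b (θ x) (θ y) = ((d : ℂ) • b) x y := by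
    rw [hT₁]
    intro x _ y hy
    rw [LinearMap.smul_apply, LinearMap.smul_apply, smul_eq_mul, hbq, hbq, h5, hθθ y ((hmem y).1 hy), map_smul,
      ← qC_apply, map_smul, smul_eq_mul, qC_apply]
  obtain ⟨T, hTalg, hTθ⟩ :=
    Varesco2023_transcendentalHodgeSimilitude_algebraic_of_lefschetzStandard.of_k3HilbertType_target hVar hB
      (n₁ := 2) (n₂ := 2) (by norm_num) (by norm_num) hIS hIS hKS hKS hK hb₁ hb (ψ := θ)
      (fun x _ hx => h1 x hx) hbij (fun i j x _ hx => h2 i j x hx) hiso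
  refine ⟨T, hTalg, fun y hy => hTθ y ?_⟩
  rw [hT₁]
  exact (hmem y).2 hy

/-- **T1 core (cycle form): `θ = [Z]_*` on `T(X)` for an algebraic class `Z ∈ A⁴(X × X)`**, the correspondence
normalised to the complex orientations (`IsAlgebraicCorrespondence.exists_eq_corrAction`; degree `e = 4` forced).
CONDITIONAL on Kuga–Satake for `X`; facts Varesco2023, CharlesMarkman2013. [cite: Varesco2023, Cor. 4.6]
[cite: CharlesMarkman2013, Thm. 1.1 (§1)] [cite: Andre1996Motifs, §2.1 (p. 14)] -/
theorem exists_corrAction_eq_on_bbfTransc_of_kugaSatake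
    (hB : CharlesMarkman2013_lefschetzStandard_K3HilbertType)
    (hVar : Varesco2023_transcendentalHodgeSimilitude_algebraic_of_lefschetzStandard)
    (hX : IsSmoothProjective 4 X) (hK : IsOfK3HilbertSquareType X) (hM : MarkedK3Sq[X, φ, P, z])
    (hIS : IsProjectiveIrreducibleSymplectic (2 * 2) X) (hKS : IsKSCorrespondenceAlgebraicHK 2 hIS.1)
    (θ : complexBetti X 2 →ₗ[ℂ] complexBetti X 2)
    (h1 : ∀ y, IsRationalClass y → IsRationalClass (θ y))
    (h2 : ∀ (i j : ℕ) y, IsOfHodgeType 4 X 2 i j y → IsOfHodgeType 4 X 2 i j (θ y))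
    (h4 : ∀ y : complexBetti X 2, ∀ d : complexBetti X 2, d ∈ algebraicClasses X 1 →
      k3HilbertForm 2 (φ (θ y)) (φ d) = 0)
    (h5 : ∀ y w : complexBetti X 2, k3HilbertForm 2 (φ (θ y)) (φ w) = k3HilbertForm 2 (φ y) (φ (θ w)))
    (d : ℚ) (hd : d ≠ 0)
    (hθθ : ∀ y : complexBetti X 2,
      (∀ e : complexBetti X 2, e ∈ algebraicClasses X 1 → k3HilbertForm 2 (φ y) (φ e) = 0) →
      θ (θ y) = (d : ℂ) • y) :
    ∃ Z ∈ algebraicClasses (X ⊗ X) 4, ∀ y : complexBetti X 2,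
      (∀ e : complexBetti X 2, e ∈ algebraicClasses X 1 → k3HilbertForm 2 (φ y) (φ e) = 0) →
      corrAction complexOrientationFamily hX hX (rfl : 2 + 2 * 4 = 2 + 2 * 4) Z y = θ y := by
  obtain ⟨T, hTalg, hTθ⟩ := exists_algebraicCorrespondence_eq_on_bbfTransc_of_kugaSatake hB hVar hX hK hM hIS
    hKS θ h1 h2 h4 h5 d hd hθθ
  obtain ⟨e, hab, γ, hγ, hT⟩ :=
    Summit.HodgeConjecture.HodgeConjecture.Ring2.AbelianAll.IsAlgebraicCorrespondence.exists_eq_corrAction hX hX hTalg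
  obtain rfl : e = 4 := by omega
  refine ⟨γ, hγ, fun y hy => ?_⟩
  rw [← hTθ y hy, hT]

end Summit.HodgeConjecture.HodgeConjecture.Theorems.MarkmanPartnerTransport.OrphanKS

end
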